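import Summits.QuantumFields.BalabanUV.Beta.GAN24.PlantedWordLaw
import Summits.QuantumFields.BalabanUV.Beta.GAN24.SecondOrderBoundedCombination

/-!
# `BalabanUV.Beta.GAN24.DerivativeItemPlantedLaw` — binder row G-an2-4 ∕ (CONV-C), routes C-R6° («VALUES») × R7 («TWO CURRENCIES»), PART 218:
# THE PLANTED LAW AND THE PAIRING DEFECT OF THE DERIVATIVE ITEM `∇_ν𝒢` OF [B5] (1.89) W.R.T. KING's PAIRING — `‖∇′_ν𝒢′ − J_R(∇_ν𝒢)J_Rᴴ‖ ≤ (CQL + 4dCst)·η` and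
# `‖(∇_ν𝒢)·Fᴴ‖ ≤ dR·Cst·η` (`F` = the pairing defect of Bałaban's averaging) — the two letters `p_W`, `f_W` of PART 217's planted word law for `W = ∇_ν𝒢`, at two levels and along
# the tower `n_k = L^k` (unit b2b-balaban-gan24-p3, gen 63; v1)

NOT IN PRINT; OUR PROOF ([folklore] bookkeeping BY NAME over the t4-ne2-p1 lineage's `Support/KingPairingPlantedLaw` (`JK`, `Pi`, `opNorm_Pi_le`, `JK_mul_conjTranspose`,
`JK_conjTranspose_mul_JK`, `sqrt_facts`, the 𝒢-proof pattern `𝒢′ − J𝒢Jᴴ = (1 − Π)𝒢′ + Π𝒢′(1 − Π) + (Π𝒢′Π − J𝒢Jᴴ)`), `Support/BalabanBlockPoincare` (`opNorm_one_sub_Pi_mul_le`,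
`opNorm_shiftM_sub_one_mul_le`), `Support/BlockPairingGeometry ∕ Faces` (`fdiff_mul_JK`, `faceF`, `opNorm_faceF_le`), `Support/BalabanLineAverage` (`Lavg`, `opNorm_Lavg_sub_one_mul_le`),
`Support/BalabanAveragingPairing` (`FQB`, `FQBlev`), b05's `B5Prop11Plancherel` ((1.89): `opNorm_fdiff_calG_le`, `opNorm_fdiff_fdiff_calG_le`, `opNorm_fdiff_calG_star_fdiff_le`,
`calG_isHermitian`) and `B5G183RateTorusW.opNorm_Qavg_fdiff_calG_rate` (KING's one-step law for the item `∇𝒢`); [Balaban1984PropagatorsI] Prop. 1.1 (1.89) p. 33 and [King1986] (2.10),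
(4.19)–(4.23), Lemma 4.5 (4.38) are the cited inputs of those leaves; nothing printed is a hypothesis).
HONEST FRAMING (cell contract, verbatim): «discharging `BetaPertH` makes Bałaban's UV stability UNCONDITIONAL — a real constructive-QFT result; it is NOT the
continuum limit and NOT the Clay problem.»  HONEST DEPENDENCY (verbatim): «continuum YM on T⁴ ⇐ BetaPertH ∧ nine spine estimates (0/9 proved); BetaPertH ⇐
(D1) ∧ (D4) ∧ CAP+tail; G-an2-4 gates asym, D1 and NE2/3/4.»

WHY (census V202′ (b′)).  PART 217's planted word law turns the operator-currency step rate of the insertion word `𝒢·diag(V)·∇_μ𝒢` of a BOUNDED NESTED background into four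
letters; two are the free tower's (`‖𝒢′ − J𝒢Jᴴ‖ ≤ CJ·η`, `‖F𝒢‖ ≤ dLCst·η`, T4 `KingPairingPlantedLaw` ∕ `BalabanAveragingPairing`), the other two concern the derivative item
`W = ∇_ν𝒢` and are typed here from what the tree already holds: King's one-step law for `∇𝒢` (`opNorm_Qavg_fdiff_calG_rate`) and the second-order (1.89) bounds
`‖∇∇𝒢‖, ‖∇𝒢∇ᴴ‖ ≤ Cst` (for the two complement defects and the one-derivative cost of the contour average).

WHAT THIS FILE PROVES (0 sorry, 0 `def`; two levels `η = 1∕N`, `η′ = η∕R`, `𝒢 = calG N`, `𝒢′ = calG (RN)`, `∇_ν = fdiff … ν`, `J = JK N R M`, `Π = JJᴴ`, `F = FQB N R M`):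
* §1 `opNorm_one_sub_Pi_mul_fdiff_calG_le` (`‖(1 − Π)∇′𝒢′‖ ≤ 2dCst·η`), `opNorm_fdiff_calG_mul_one_sub_Pi_le` (`‖∇′𝒢′(1 − Π)‖ ≤ 2dCst·η`),
  `opNorm_Pi_fdiff_calG_Pi_sub_planted_le` (`‖Π∇′𝒢′Π − J(∇𝒢)Jᴴ‖ ≤ CQL·η`), **`opNorm_fdiff_calG_sub_planted_le`** (`‖∇′𝒢′ − J(∇𝒢)Jᴴ‖ ≤ (CQL + 4dCst)·η`).
* §2 `opNorm_fdiff_planted_star_fdiff_le` (`‖∇′_μ(J(𝒢∇_νᴴ)Jᴴ)‖ ≤ R·Cst`), **`opNorm_fdiff_calG_mul_FQB_conjTranspose_le`** (`‖(∇_ν𝒢)Fᴴ‖ ≤ dR·Cst·η`).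
* §3 along the tower `n_k = L^k`: **`plantedW_le_lev`**, **`pairingW_le_lev`** — the letters `p_W k ≤ (CQL + 4dCst)·L^{−k}`, `f_W k ≤ dLCst·L^{−k}` for
  `W_k = fdiff (fine n_k M) n_k ν · calGlev k` against `JpcT`, `FQBlev`; and `plantedG_le_lev` (`‖calGlev (k+1) − J calGlev k Jᴴ‖ ≤ CJ·L^{−k}`, T4's letter re-read for `calGlev`).
WHAT IT DOES NOT DO: the nested indicator multipliers and the word tower (PART 219); anything with two insertions.
SUPPLIER work; NEVER «G-an2-4 closed»; NOT (CONV-C), NOT D1, NOT `BetaPertH`, NOT continuum, NOT Clay.  Records: `HOME/b2b-balaban-gan24-p3/gen63/README.md`.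
-/

noncomputable section

open scoped BigOperators ComplexConjugate Matrix Matrix.Norms.L2Operator
open Filter Topology

namespace Summit.QuantumFields.BalabanUV.Beta.GAN24.DerivativeItemPlantedLaw

open Literature.MathematicalPhysics.QuantumFieldTheory.Balaban1983to89.B5Prop11Plancherel
open Literature.MathematicalPhysics.QuantumFieldTheory.Balaban1983to89.B5G183RateTorusW
open Literature.MathematicalPhysics.QuantumFieldTheory.Balaban1983to89.B5G183RateUnitTower (lev lev_neZero)
open Summit.QuantumFields.BalabanUV.T4Continuum
open Summit.QuantumFields.BalabanUV.T4Continuum.BalabanBlockPoincare (Pi opNorm_one_sub_Pi_mul_le opNorm_shiftM_sub_one_mul_le)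
open Summit.QuantumFields.BalabanUV.T4Continuum.BalabanLineAverage (Lavg QB opNorm_Lavg_sub_one_mul_le)
open Summit.QuantumFields.BalabanUV.T4Continuum.BalabanAveragedTowerUnit (idx QBlev Qlev calGlev one_le_lev' cast_lev')
open Summit.QuantumFields.BalabanUV.T4Continuum.KingPairingPlantedLaw
open Summit.QuantumFields.BalabanUV.T4Continuum.BlockPairingGeometry
open Summit.QuantumFields.BalabanUV.T4Continuum.BlockPairingFaces
open Summit.QuantumFields.BalabanUV.T4Continuum.BalabanAveragingPairing (FQB FQBlev)

variable {d : ℕ}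

/-! ## §1 The planted law of `∇_ν𝒢` w.r.t. King's pairing -/

section TwoLevel

variable (N R : ℕ) [NeZero N] [NeZero R] (M : Fin d → ℕ) [hM : ∀ μ, NeZero (M μ)] (a : ℝ) (ha : 0 < a)

/-- `‖(1 − Π)·∇′_ν𝒢′‖ ≤ 2dCst·η` — block Poincaré with the axis defects `‖(S^μ − 1)∇′_ν𝒢′‖ ≤ Cst∕(RN)` from `‖∇∇𝒢‖ ≤ Cst` ((1.89), fifth item). [folklore] -/
theorem opNorm_one_sub_Pi_mul_fdiff_calG_le (hN : 1 ≤ N) (hRN : 1 ≤ R * N) (ν : Fin d) :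
    ‖(1 - Pi N R M) * (fdiff (fine (R * N) M) (((R * N : ℕ)) : ℂ) ν * calG (R * N) hRN M a ha)‖ ≤ 2 * d * Cst d a / N := by
  have hNpos : (0 : ℝ) < N := by exact_mod_cast hN
  have hRpos : (0 : ℝ) < R := by exact_mod_cast Nat.pos_of_ne_zero (NeZero.ne R)
  have hc : (((R * N : ℕ) : ℂ)) ≠ 0 := by exact_mod_cast (Nat.pos_iff_ne_zero.mp hRN)
  have hcn : ‖(((R * N : ℕ) : ℂ))‖ = (R : ℝ) * N := by rw [Complex.norm_natCast]; push_cast; ring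
  have hCst := Cst_nonneg d a
  have hX : ∀ μ, ‖(shiftM (fine (R * N) M) μ - 1) * (fdiff (fine (R * N) M) (((R * N : ℕ)) : ℂ) ν * calG (R * N) hRN M a ha)‖ ≤ Cst d a / ((R : ℝ) * N) := by
    intro μ
    have hb : ‖fdiff (fine (R * N) M) (((R * N : ℕ)) : ℂ) μ * (fdiff (fine (R * N) M) (((R * N : ℕ)) : ℂ) ν * calG (R * N) hRN M a ha)‖ ≤ Cst d a := by
      rw [← Matrix.mul_assoc]; exact opNorm_fdiff_fdiff_calG_le (R * N) hRN M a ha μ ν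
    have h := opNorm_shiftM_sub_one_mul_le _ hc μ hb
    rwa [hcn] at h
  have hδ : 0 ≤ Cst d a / ((R : ℝ) * N) := by positivity
  refine (opNorm_one_sub_Pi_mul_le N R M _ hδ hX).trans (le_of_eq ?_)
  field_simp

/-- `‖∇′_ν𝒢′·(1 − Π)‖ ≤ 2dCst·η` — the adjoint form: `∇′𝒢′(1 − Π) = ((1 − Π)·𝒢′∇′ᴴ)ᴴ` and `‖(S^μ − 1)𝒢′∇′_νᴴ‖ ≤ Cst∕(RN)` from `‖∇𝒢∇ᴴ‖ ≤ Cst` ((1.89), fourth item). [folklore] -/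
theorem opNorm_fdiff_calG_mul_one_sub_Pi_le (hN : 1 ≤ N) (hRN : 1 ≤ R * N) (ν : Fin d) :
    ‖fdiff (fine (R * N) M) (((R * N : ℕ)) : ℂ) ν * calG (R * N) hRN M a ha * (1 - JK N R M * (JK N R M)ᴴ)‖ ≤ 2 * d * Cst d a / N := by
  have hNpos : (0 : ℝ) < N := by exact_mod_cast hN
  have hRpos : (0 : ℝ) < R := by exact_mod_cast Nat.pos_of_ne_zero (NeZero.ne R)
  have hc : (((R * N : ℕ) : ℂ)) ≠ 0 := by exact_mod_cast (Nat.pos_iff_ne_zero.mp hRN)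
  have hcn : ‖(((R * N : ℕ) : ℂ))‖ = (R : ℝ) * N := by rw [Complex.norm_natCast]; push_cast; ring
  have hCst := Cst_nonneg d a
  have e : fdiff (fine (R * N) M) (((R * N : ℕ)) : ℂ) ν * calG (R * N) hRN M a ha * (1 - JK N R M * (JK N R M)ᴴ)
      = ((1 - Pi N R M) * (calG (R * N) hRN M a ha * star (fdiff (fine (R * N) M) (((R * N : ℕ)) : ℂ) ν)))ᴴ := by
    rw [JK_mul_conjTranspose, Matrix.conjTranspose_mul, Matrix.conjTranspose_mul, Matrix.conjTranspose_sub, Matrix.conjTranspose_one, Pi_conjTranspose,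
      (calG_isHermitian (R * N) hRN M a ha).eq, Matrix.star_eq_conjTranspose, Matrix.conjTranspose_conjTranspose, Matrix.mul_assoc]
  rw [e, Matrix.l2_opNorm_conjTranspose]
  have hX : ∀ μ, ‖(shiftM (fine (R * N) M) μ - 1) * (calG (R * N) hRN M a ha * star (fdiff (fine (R * N) M) (((R * N : ℕ)) : ℂ) ν))‖ ≤ Cst d a / ((R : ℝ) * N) := by
    intro μ
    have hb : ‖fdiff (fine (R * N) M) (((R * N : ℕ)) : ℂ) μ * (calG (R * N) hRN M a ha * star (fdiff (fine (R * N) M) (((R * N : ℕ)) : ℂ) ν))‖ ≤ Cst d a := by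
      rw [← Matrix.mul_assoc]; exact opNorm_fdiff_calG_star_fdiff_le (R * N) hRN M a ha μ ν
    have h := opNorm_shiftM_sub_one_mul_le _ hc μ hb
    rwa [hcn] at h
  have hδ : 0 ≤ Cst d a / ((R : ℝ) * N) := by positivity
  refine (opNorm_one_sub_Pi_mul_le N R M _ hδ hX).trans (le_of_eq ?_)
  field_simp

/-- `‖Π∇′_ν𝒢′Π − J(∇_ν𝒢)Jᴴ‖ ≤ CQL·η` — `Π∇′𝒢′Π − J(∇𝒢)Jᴴ = J(R^dQ(∇′𝒢′)Qᴴ − ∇𝒢)Jᴴ` and KING's one-step law for the derivative item (`opNorm_Qavg_fdiff_calG_rate`).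
[folklore] -/
theorem opNorm_Pi_fdiff_calG_Pi_sub_planted_le (hN : 1 ≤ N) (hR : 1 ≤ R) (hRN : 1 ≤ R * N) (ν : Fin d) :
    ‖Pi N R M * (fdiff (fine (R * N) M) (((R * N : ℕ)) : ℂ) ν * calG (R * N) hRN M a ha) * Pi N R M
        - JK N R M * (fdiff (fine N M) ((N : ℕ) : ℂ) ν * calG N hN M a ha) * (JK N R M)ᴴ‖ ≤ CQL d a / N := by
  have hRd : (0 : ℝ) < (R : ℝ) ^ d := pow_pos (by exact_mod_cast Nat.pos_of_ne_zero (NeZero.ne R)) d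
  have hRc : ((R : ℂ) ^ d) ≠ 0 := pow_ne_zero _ (by exact_mod_cast NeZero.ne R)
  obtain ⟨hs, hss⟩ := sqrt_facts (d := d) R
  set W' := fdiff (fine (R * N) M) (((R * N : ℕ)) : ℂ) ν * calG (R * N) hRN M a ha
  set W := fdiff (fine N M) ((N : ℕ) : ℂ) ν * calG N hN M a ha
  set Q := Qavg N R M
  have e1 : Pi N R M * W' * Pi N R M - JK N R M * W * (JK N R M)ᴴ = JK N R M * ((JK N R M)ᴴ * W' * JK N R M - W) * (JK N R M)ᴴ := by
    rw [← JK_mul_conjTranspose, Matrix.mul_sub, Matrix.sub_mul]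
    simp only [Matrix.mul_assoc]
  have e2 : (JK N R M)ᴴ * W' * JK N R M = ((R : ℂ) ^ d) • (Q * W' * Qᴴ) := by
    rw [JK, Matrix.conjTranspose_smul, Matrix.conjTranspose_conjTranspose, hs, Matrix.smul_mul, Matrix.smul_mul, Matrix.mul_smul, smul_smul, hss]
  rw [e1, e2]
  have hJ := opNorm_JK_le N R M
  have hJ' : ‖(JK N R M)ᴴ‖ ≤ 1 := by rw [Matrix.l2_opNorm_conjTranspose]; exact hJ
  have hK := opNorm_Qavg_fdiff_calG_rate N R M hN hR hRN a ha ν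
  have hK' : ‖((R : ℂ) ^ d) • (Q * W' * Qᴴ) - W‖ ≤ CQL d a / N := by
    have e3 : ((R : ℂ) ^ d) • (Q * W' * Qᴴ) - W = ((R : ℂ) ^ d) • (Q * W' * Qᴴ - ((R : ℂ) ^ d)⁻¹ • W) := by
      rw [smul_sub, smul_smul, mul_inv_cancel₀ hRc, one_smul]
    rw [e3, norm_smul, norm_pow, Complex.norm_natCast]
    calc (R : ℝ) ^ d * ‖Q * W' * Qᴴ - ((R : ℂ) ^ d)⁻¹ • W‖ ≤ (R : ℝ) ^ d * (((R : ℝ) ^ d)⁻¹ * CQL d a / N) := mul_le_mul_of_nonneg_left hK hRd.le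
      _ = CQL d a / N := by field_simp
  have h0 : 0 ≤ CQL d a / N := (norm_nonneg _).trans hK'
  calc ‖JK N R M * (((R : ℂ) ^ d) • (Q * W' * Qᴴ) - W) * (JK N R M)ᴴ‖
      ≤ ‖JK N R M * (((R : ℂ) ^ d) • (Q * W' * Qᴴ) - W)‖ * ‖(JK N R M)ᴴ‖ := Matrix.l2_opNorm_mul _ _
    _ ≤ ‖JK N R M‖ * ‖((R : ℂ) ^ d) • (Q * W' * Qᴴ) - W‖ * ‖(JK N R M)ᴴ‖ := mul_le_mul_of_nonneg_right (Matrix.l2_opNorm_mul _ _) (norm_nonneg _)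
    _ ≤ 1 * (CQL d a / N) * 1 := mul_le_mul (mul_le_mul hJ hK' (norm_nonneg _) zero_le_one) hJ' (norm_nonneg _) (by positivity)
    _ = CQL d a / N := by ring

/-- **`opNorm_fdiff_calG_sub_planted_le` — THE PLANTED LAW OF THE DERIVATIVE ITEM**: `‖∇′_ν𝒢′ − J(∇_ν𝒢)Jᴴ‖ ≤ (CQL + 4dCst)·η` — the finer `∇𝒢` IS the
piecewise-constantly planted coarser one up to `O(η)` in operator norm; from `∇′𝒢′ − J(∇𝒢)Jᴴ = (1 − Π)∇′𝒢′ + Π·∇′𝒢′(1 − Π) + (Π∇′𝒢′Π − J(∇𝒢)Jᴴ)`.  Statement and constant OURS.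
[folklore] -/
theorem opNorm_fdiff_calG_sub_planted_le (hN : 1 ≤ N) (hR : 1 ≤ R) (hRN : 1 ≤ R * N) (ν : Fin d) :
    ‖fdiff (fine (R * N) M) (((R * N : ℕ)) : ℂ) ν * calG (R * N) hRN M a ha - JK N R M * (fdiff (fine N M) ((N : ℕ) : ℂ) ν * calG N hN M a ha) * (JK N R M)ᴴ‖
      ≤ (CQL d a + 4 * d * Cst d a) / N := by
  set W' := fdiff (fine (R * N) M) (((R * N : ℕ)) : ℂ) ν * calG (R * N) hRN M a ha
  set P0 := Pi N R M
  have e : W' - JK N R M * (fdiff (fine N M) ((N : ℕ) : ℂ) ν * calG N hN M a ha) * (JK N R M)ᴴ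
      = (1 - P0) * W' + P0 * (W' * (1 - JK N R M * (JK N R M)ᴴ))
        + (P0 * W' * P0 - JK N R M * (fdiff (fine N M) ((N : ℕ) : ℂ) ν * calG N hN M a ha) * (JK N R M)ᴴ) := by
    rw [JK_mul_conjTranspose, Matrix.sub_mul, Matrix.one_mul, Matrix.mul_sub, Matrix.mul_one, Matrix.mul_sub, ← Matrix.mul_assoc P0 W' P0]
    abel
  rw [e]
  have h1 := opNorm_one_sub_Pi_mul_fdiff_calG_le N R M a ha hN hRN ν
  have h2 := opNorm_fdiff_calG_mul_one_sub_Pi_le N R M a ha hN hRN ν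
  have h3 := opNorm_Pi_fdiff_calG_Pi_sub_planted_le N R M a ha hN hR hRN ν
  have hPi := opNorm_Pi_le N R M
  have h2' : ‖P0 * (W' * (1 - JK N R M * (JK N R M)ᴴ))‖ ≤ 2 * d * Cst d a / N :=
    (Matrix.l2_opNorm_mul _ _).trans ((mul_le_mul hPi h2 (norm_nonneg _) zero_le_one).trans (le_of_eq (one_mul _)))
  calc _ ≤ ‖(1 - P0) * W' + P0 * (W' * (1 - JK N R M * (JK N R M)ᴴ))‖
          + ‖P0 * W' * P0 - JK N R M * (fdiff (fine N M) ((N : ℕ) : ℂ) ν * calG N hN M a ha) * (JK N R M)ᴴ‖ := norm_add_le _ _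
    _ ≤ (‖(1 - P0) * W'‖ + ‖P0 * (W' * (1 - JK N R M * (JK N R M)ᴴ))‖)
          + ‖P0 * W' * P0 - JK N R M * (fdiff (fine N M) ((N : ℕ) : ℂ) ν * calG N hN M a ha) * (JK N R M)ᴴ‖ := add_le_add (norm_add_le _ _) le_rfl
    _ ≤ (2 * d * Cst d a / N + 2 * d * Cst d a / N) + CQL d a / N := add_le_add (add_le_add h1 h2') h3
    _ = (CQL d a + 4 * d * Cst d a) / N := by ring

/-! ## §2 The pairing defect of Bałaban's averaging against the derivative item -/

/-- `‖∇′_μ·(J(𝒢∇_νᴴ)Jᴴ)‖ ≤ R·Cst` — fine derivatives of the planted `𝒢∇ᴴ` (`∇′J = R·FJ∇`, `‖∇_μ𝒢∇_νᴴ‖ ≤ Cst`). [folklore] -/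
theorem opNorm_fdiff_planted_star_fdiff_le (hN : 1 ≤ N) (μ ν : Fin d) :
    ‖fdiff (fine (R * N) M) (((R * N : ℕ)) : ℂ) μ * (JK N R M * (calG N hN M a ha * star (fdiff (fine N M) ((N : ℕ) : ℂ) ν)) * (JK N R M)ᴴ)‖ ≤ R * Cst d a := by
  have hC := Cst_nonneg d a
  have e : fdiff (fine (R * N) M) (((R * N : ℕ)) : ℂ) μ * (JK N R M * (calG N hN M a ha * star (fdiff (fine N M) ((N : ℕ) : ℂ) ν)) * (JK N R M)ᴴ)
      = ((R : ℂ)) • ((faceF N R M μ * JK N R M) * (fdiff (fine N M) ((N : ℕ) : ℂ) μ * (calG N hN M a ha * star (fdiff (fine N M) ((N : ℕ) : ℂ) ν))) * (JK N R M)ᴴ) := by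
    rw [← Matrix.mul_assoc, ← Matrix.mul_assoc, fdiff_mul_JK N R M hN μ, Matrix.smul_mul, Matrix.smul_mul]
    simp only [Matrix.mul_assoc]
  rw [e, norm_smul, Complex.norm_natCast]
  refine mul_le_mul_of_nonneg_left ?_ (Nat.cast_nonneg R)
  have hFJ : ‖faceF N R M μ * JK N R M‖ ≤ 1 :=
    (Matrix.l2_opNorm_mul _ _).trans ((mul_le_mul (opNorm_faceF_le N R M μ) (opNorm_JK_le N R M) (norm_nonneg _) zero_le_one).trans (le_of_eq (one_mul 1)))
  have hJ' : ‖(JK N R M)ᴴ‖ ≤ 1 := by rw [Matrix.l2_opNorm_conjTranspose]; exact opNorm_JK_le N R M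
  have hb : ‖fdiff (fine N M) ((N : ℕ) : ℂ) μ * (calG N hN M a ha * star (fdiff (fine N M) ((N : ℕ) : ℂ) ν))‖ ≤ Cst d a := by
    rw [← Matrix.mul_assoc]; exact opNorm_fdiff_calG_star_fdiff_le N hN M a ha μ ν
  calc _ ≤ ‖faceF N R M μ * JK N R M * (fdiff (fine N M) ((N : ℕ) : ℂ) μ * (calG N hN M a ha * star (fdiff (fine N M) ((N : ℕ) : ℂ) ν)))‖ * ‖(JK N R M)ᴴ‖ := Matrix.l2_opNorm_mul _ _
    _ ≤ (1 * Cst d a) * 1 := by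
        refine mul_le_mul ((Matrix.l2_opNorm_mul _ _).trans (mul_le_mul hFJ hb (norm_nonneg _) zero_le_one)) hJ' (norm_nonneg _) (by positivity)
    _ = Cst d a := by ring

/-- **`opNorm_fdiff_calG_mul_FQB_conjTranspose_le` — THE PAIRING DEFECT OF BAŁABAN's AVERAGING AGAINST THE DERIVATIVE ITEM**: `‖(∇_ν𝒢)·Fᴴ‖ ≤ dR·Cst·η`
(`(∇𝒢)Fᴴ = (F·𝒢∇ᴴ)ᴴ`, `F·𝒢∇ᴴ = √(R^d)·Q(Lavg − 1)(J𝒢∇ᴴJᴴ)J`, the contour average moves the planted `𝒢∇ᴴ` by `O(η)` by §2's one-derivative cost). [folklore] -/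
theorem opNorm_fdiff_calG_mul_FQB_conjTranspose_le (hN : 1 ≤ N) (hRN : 1 ≤ R * N) (ν : Fin d) :
    ‖fdiff (fine N M) ((N : ℕ) : ℂ) ν * calG N hN M a ha * (FQB N R M)ᴴ‖ ≤ d * R * Cst d a / N := by
  have hRd : (0 : ℝ) < (R : ℝ) ^ d := pow_pos (by exact_mod_cast Nat.pos_of_ne_zero (NeZero.ne R)) d
  have hs0 : 0 < Real.sqrt ((R : ℝ) ^ d) := Real.sqrt_pos.mpr hRd
  have hc : (((R * N : ℕ) : ℂ)) ≠ 0 := by exact_mod_cast (Nat.pos_iff_ne_zero.mp hRN)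
  have hcn : ‖(((R * N : ℕ) : ℂ))‖ = (R : ℝ) * N := by rw [Complex.norm_natCast]; push_cast; ring
  have hNpos : (0 : ℝ) < N := by exact_mod_cast hN
  have hRpos : (0 : ℝ) < R := by exact_mod_cast Nat.pos_of_ne_zero (NeZero.ne R)
  set X := calG N hN M a ha * star (fdiff (fine N M) ((N : ℕ) : ℂ) ν) with hXdef
  -- adjoint: `(∇𝒢)Fᴴ = (F·𝒢∇ᴴ)ᴴ`
  have e0 : fdiff (fine N M) ((N : ℕ) : ℂ) ν * calG N hN M a ha * (FQB N R M)ᴴ = (FQB N R M * X)ᴴ := by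
    rw [hXdef, Matrix.conjTranspose_mul, Matrix.conjTranspose_mul, Matrix.star_eq_conjTranspose, Matrix.conjTranspose_conjTranspose,
      (calG_isHermitian N hN M a ha).eq, Matrix.mul_assoc]
  rw [e0, Matrix.l2_opNorm_conjTranspose]
  -- `F X = √(R^d) Q (Lavg − 1)(J X Jᴴ) J`
  have e : FQB N R M * X = (((Real.sqrt ((R : ℝ) ^ d)) : ℝ) : ℂ) • (Qavg N R M * ((Lavg (fine (R * N) M) R - 1) * (JK N R M * X * (JK N R M)ᴴ)) * JK N R M) := by
    rw [FQB, Matrix.smul_mul]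
    congr 1
    have hJJ : JK N R M * X * (JK N R M)ᴴ * JK N R M = JK N R M * X := by
      rw [Matrix.mul_assoc (JK N R M * X), JK_conjTranspose_mul_JK, Matrix.mul_one]
    calc Qavg N R M * (Lavg (fine (R * N) M) R - 1) * JK N R M * X
        = Qavg N R M * (Lavg (fine (R * N) M) R - 1) * (JK N R M * X) := by simp only [Matrix.mul_assoc]
      _ = Qavg N R M * (Lavg (fine (R * N) M) R - 1) * (JK N R M * X * (JK N R M)ᴴ * JK N R M) := by rw [hJJ]
      _ = _ := by simp only [Matrix.mul_assoc]
  rw [e, norm_smul, Complex.norm_real, Real.norm_of_nonneg hs0.le]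
  -- the contour average moves the planted `𝒢∇ᴴ` by `O(η)`
  have h1 : ‖(Lavg (fine (R * N) M) R - 1) * (JK N R M * X * (JK N R M)ᴴ)‖ ≤ d * R * Cst d a / N := by
    have h := opNorm_Lavg_sub_one_mul_le (fine (R * N) M) R (JK N R M * X * (JK N R M)ᴴ) hc
      (fun μ => opNorm_fdiff_planted_star_fdiff_le N R M a ha hN μ ν)
    rw [hcn] at h
    refine h.trans (le_of_eq ?_)
    field_simp
  have h0 : 0 ≤ d * R * Cst d a / N := (norm_nonneg _).trans h1
  calc Real.sqrt ((R : ℝ) ^ d) * ‖Qavg N R M * ((Lavg (fine (R * N) M) R - 1) * (JK N R M * X * (JK N R M)ᴴ)) * JK N R M‖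
      ≤ Real.sqrt ((R : ℝ) ^ d) * (‖Qavg N R M‖ * (d * R * Cst d a / N) * 1) := by
        refine mul_le_mul_of_nonneg_left ?_ hs0.le
        calc _ ≤ ‖Qavg N R M * ((Lavg (fine (R * N) M) R - 1) * (JK N R M * X * (JK N R M)ᴴ))‖ * ‖JK N R M‖ := Matrix.l2_opNorm_mul _ _
          _ ≤ ‖Qavg N R M‖ * (d * R * Cst d a / N) * 1 :=
              mul_le_mul ((Matrix.l2_opNorm_mul _ _).trans (mul_le_mul_of_nonneg_left h1 (norm_nonneg _))) (opNorm_JK_le N R M) (norm_nonneg _) (mul_nonneg (norm_nonneg _) h0)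
    _ ≤ Real.sqrt ((R : ℝ) ^ d) * ((Real.sqrt ((R : ℝ) ^ d))⁻¹ * (d * R * Cst d a / N) * 1) := by
        refine mul_le_mul_of_nonneg_left ?_ hs0.le
        exact mul_le_mul_of_nonneg_right (mul_le_mul_of_nonneg_right (opNorm_Qavg_le N R M) h0) zero_le_one
    _ = d * R * Cst d a / N := by field_simp

end TwoLevel

/-! ## §3 Along the tower `n_k = L^k`: the letters `p_G`, `p_W`, `f_W` as geometric sequences -/

section TowerLevel

variable (L : ℕ) [NeZero L] (M : Fin d → ℕ) [hM : ∀ μ, NeZero (M μ)] (a : ℝ) (ha : 0 < a)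

/-- `p_G`: `‖𝒢^{(k+1)} − J_k𝒢^{(k)}J_kᴴ‖ ≤ CJ·L^{−k}` (T4's planted law, read for `calGlev`). [folklore] -/
theorem plantedG_le_lev (k : ℕ) :
    ‖calGlev L M a ha (k + 1) - JpcT L M k * calGlev L M a ha k * (JpcT L M k)ᴴ‖ ≤ CJ d a * ((L : ℝ)⁻¹) ^ k := by
  have hL1 : 1 ≤ L := Nat.pos_of_ne_zero (NeZero.ne L)
  have h := opNorm_calG_sub_planted_le (lev L k) L M a ha (one_le_lev' L k) hL1 (one_le_lev' L (k + 1))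
  rw [cast_lev'] at h
  rw [inv_pow, ← div_eq_mul_inv]
  exact h

/-- **`plantedW_le_lev` — `p_W`**: `‖∇_ν^{(k+1)}𝒢^{(k+1)} − J_k(∇_ν^{(k)}𝒢^{(k)})J_kᴴ‖ ≤ (CQL + 4dCst)·L^{−k}`. [folklore] -/
theorem plantedW_le_lev (k : ℕ) (ν : Fin d) :
    ‖fdiff (fine (lev L (k + 1)) M) ((lev L (k + 1) : ℕ) : ℂ) ν * calGlev L M a ha (k + 1)
        - JpcT L M k * (fdiff (fine (lev L k) M) ((lev L k : ℕ) : ℂ) ν * calGlev L M a ha k) * (JpcT L M k)ᴴ‖ ≤ (CQL d a + 4 * d * Cst d a) * ((L : ℝ)⁻¹) ^ k := by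
  have hL1 : 1 ≤ L := Nat.pos_of_ne_zero (NeZero.ne L)
  have h := opNorm_fdiff_calG_sub_planted_le (lev L k) L M a ha (one_le_lev' L k) hL1 (one_le_lev' L (k + 1)) ν
  rw [cast_lev'] at h
  rw [inv_pow, ← div_eq_mul_inv]
  exact h

/-- **`pairingW_le_lev` — `f_W`**: `‖(∇_ν^{(k)}𝒢^{(k)})·F_kᴴ‖ ≤ dLCst·L^{−k}`. [folklore] -/
theorem pairingW_le_lev (k : ℕ) (ν : Fin d) :
    ‖fdiff (fine (lev L k) M) ((lev L k : ℕ) : ℂ) ν * calGlev L M a ha k * (FQBlev L M k)ᴴ‖ ≤ d * L * Cst d a * ((L : ℝ)⁻¹) ^ k := by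
  have h := opNorm_fdiff_calG_mul_FQB_conjTranspose_le (lev L k) L M a ha (one_le_lev' L k) (one_le_lev' L (k + 1)) ν
  rw [cast_lev'] at h
  rw [inv_pow, ← div_eq_mul_inv]
  exact h

end TowerLevel

end Summit.QuantumFields.BalabanUV.Beta.GAN24.DerivativeItemPlantedLaw

end
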